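import Summits.FinalStateConjecture.FinalStateConjecture.Theses.SwallowTheDatum
import Summits.FinalStateConjecture.FinalStateConjecture.Theorems.KerrShieldedDataExist.Negative.BentSliceConormal
import HarnessLib

/-!
# Line `null-glue-to-a-trapped-sphere` — skeleton for the crux `SwallowTheDatum.KerrShieldedDataExist`
(stmt-FinalStateConjecture-10055; crux-plan, round 1; planner-cruxplan-…-null-glue-to-a-trapp-0, 2026-08-16)

Crux (FIXED, concluded BY NAME below): `∀ [Kerr.Facts], ∃ D ∈ admissibleVacuumData E3, ∃ M a r₁ (hM : 0 ≤ M) T φ ψ ν,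
|a| < M ∧ r₋ < r₁ < r₊ ∧ T = ⟨hard-coded bent height⟩ ∧ IsCompact (range φ)ᶜ ∧ IsOpenEmbedding φ ∧ C^∞ φ ∧
ψ = graph of T∘r ∧ ψ spacelike ∧ ν future unit normal ∧ φ^*h = ψ^*g_{M,a} ∧ φ^*k = K_ν(ψ)`.

## The line (idea card `Ideas/null-glue-to-a-trapped-sphere.md`, sharpened by TRIAGE-r1-{1,2,3})

LEVER: Kehle–Unger's non-perturbative characteristic gluing of a Minkowski cone to a TRAPPED Schwarzschild
symmetry sphere `R = 2M − ε` (arXiv:2304.08455, Thm A p. 16 "Let M > 0, R > 0, k ∈ ℕ"; Cor. 2 p. 4: one-ended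
vacuum data on `ℝ³` whose development contains, for `v ≥ v₀`, the exact Kruskal region
`𝓔 = {U ≤ U₂, V ≥ V₂, r > 0}` — exterior, event horizon and a double-null slab down to `r = 0`).

HARVEST (stub A): the LATE Kerr–Schild slice `{t* = T₁, r > r₀}` lies in `𝓔` for every `r₀ > 0` once
`T₁ ≫ 1` (`U = (1 − r/2M)e^{(r−T₁)/4M} ≤ e^{−T₁/4M} < U₂`, `v = T₁ + r ≥ v₀`). Continue it inside `r₀` by a
spherically symmetric PAST-directed bend `t* = T₁ − S(r)` (`S ≥ 0`, `S ≡ 0` near `r₀`; every slope `≥ 0` is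
spacelike inside the hole: `Negative.conormalForm_zero_spin_neg_of_lt`) until it meets the glued cone
`C = {U = U₂}` at a sphere `S_c` of radius `r_c < r₀ ≤ R` (then `V(S_c) ≥ V₂`: `S_c` lies on the EXACT
portion of `C`), cross `C` transversally, hug `C` from the future side inside the thin local-existence slab
down to `v = v₁`, cross the ingoing cone `C̲⁺_{S₁}` of the bottom sphere (a `C^k` seam: K–U match
`C²_u C^{2+m}_v` sphere data, Def. 2.2 p. 8) into the exactly FLAT diamond `D(B) = {u ≥ 0, v ≤ v₁}` and close
with a flat ball. The induced datum is `C² × C¹` on `ℝ³` (the spacetime is `C²` across `C`, p. 18 L33;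
smoother elsewhere), solves the vacuum constraints classically (Gauss–Codazzi pointwise), is complete, and
IS the Schwarzschild(`M`) Kerr–Schild slice data on `{‖y‖ > r₀}`.  Triage r1-1/r1-3 are right that the
`C²` seam is UNAVOIDABLE (every route from `{U < U₂}` to a regular centre crosses a null seam through `S₁`;
`C`, `C⁻` carry the order-3 jump) — so the kink is placed where the adjacent exact collar has KNOWN KIDs.

SMOOTHING + REGLUING (stub B, the HEART): mollify the whole cap `{‖y‖ ≤ r₂}` (constraint violation `→ 0`
in `C⁰`, supported in a ball whose boundary collar is exact Schwarzschild KS data), and re-impose the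
constraints by a Corvino–Schoen/Chruściel–Delay localized deformation on the ball `{‖y‖ < r₃}` glued across
the KS collar `{r₂ < ‖y‖ < r₃}` to the 4-parameter family of exact Kerr(`m`, 𝐚) Kerr–Schild slice data
(Li–Mei arXiv:2005.01249 Prop. 4.1 moved from the cylinder `{r = r₀}` to a KS collar; the cokernel of the
LIMIT background on the ball is ⊆ the restrictions of the 4 Schwarzschild KIDs `∂_t ⊕ so(3)` by unique
continuation from the collar, and `(m, 𝐚) ↦ (E, 𝐉)` is transversal to all of it — NO genericity / no-KID
hypothesis on the Kehle–Unger cap is needed).  Low-regularity uniformity (the triage DOUBT, card "Leans on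
(i)"): backgrounds converge only in `C² × C¹`; planner's repair = FREEZE THE ADJOINT at a fixed smooth
`C²`-close background `g₀` (seek `δ = ψ² DΦ*_{g₀}(N,Y)`): the operator `DΦ_{g_ε} ψ² DΦ*_{g₀}` is 4th order
with continuous top-order and uniformly `L^∞` lower-order coefficients (only `≤ 2` derivatives of `g_ε`
enter), so `L^p`/weighted-`L²` elliptic theory and the no-kernel compactness argument are uniform under
`C² × C¹` convergence (`Ric(g_ε) → Ric(g)` in `C⁰`); Picard in weighted `H⁴ → H²` (`Q : H² → L²` is
quadratically bounded in 3D), bootstrap for fixed `ε`.  Output: a smooth complete vacuum datum on `E3`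
equal, on `ρ(Kerr.slice a r₃)` for a linear isometry `ρ` (axis of 𝐚 ↦ `e_z`, `a = |𝐚|`), to the Kerr(`m`,`a`)
KS slice data, with `r₋(m,a) < r₃ < r₊(m,a)` (`(m,a) → (M,0)`).

PATCH + CERTIFY (stub C): the typed bent leaf of Kerr(`m`,`a`) coincides with the KS slice on `{r ≤ 4m}`
(`Negative.bentHeight_eq_zero_of_le`, `Negative.graph_eq_sliceEmbed_of_le`) and `r₃ < r₊ ≤ 2m < 4m`, so the
datum can be replaced on `ρ({r > r₃})` by the exact bent-leaf data WITHOUT any PDE (the two smooth data agree on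
the open overlap `ρ({r₃ < r < 4m})`); the result is vacuum (Gauss–Codazzi in exact Kerr), complete, has ONE
DR-asymptotically-flat end (Boyer–Lindquist end read in the radially shifted quasi-isotropic chart; Disproof §7:
the tautological KS chart would fail, `Kerr.not_isStronglyAsymptoticallyFlatDR_data`), and satisfies the slice
clause (`Negative.conormalForm_bentSlope_neg` + `psi_eq_graph` + the `mfderiv` plumbing of Disproof §8.1).

## Disproof.lean honoured (tree `Cruxes/KerrShieldedDataExist/Disproof.lean`, gen 2; landed Negative/*)
* `no_window_of_not_subextremal` / `abs_lt_of_window`: every stub keeps `|a| < m` AND the window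
  `rMinus m a < r₃ < rPlus m a` (stub B delivers both; `a = |𝐚|` is `O(ε)`-small, `m ≈ M`, `r₃ < 2M`).
* §7 "unbent slice with tautological chart dies" / near-miss `unbentShield_not_admissible`: stubs A–B work with
  the UNBENT KS slice on purpose (intermediate data are not claimed admissible); admissibility is certified only
  in stub C AFTER patching in the Boyer–Lindquist bend beyond `4m`, with the EXISTENTIAL end chart.
* §5 `conormalForm_bentSlope_neg`, §6 `psi_eq_graph`, `graph_eq_sliceEmbed_of_le`, `Kerr.isSpacelikeImmersion_sliceEmbed_holds`,
  `Kerr.isFutureUnitNormal_sliceNormal_holds`: consumed by stub C (slice clause costs nothing new).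
* §8(c): "Kehle–Unger … `C²` regularity must be upgraded — its weak point" = stub B, isolated as ONE general lemma.
* `ledger negatives --problem FinalStateConjecture`: 0.  Barrier catalogue: all entries dynamical; none constrains
  the existence of one datum (Disproof §8, TRIAGE r1-1..3 concur).

## Shape
Three registered stubs (`stub_roughShieldOfNullGluing`, `stub_roughCollarRegluing`, `stub_bentLeafPatching`),
their statements named in `namespace Registered` (so that the composition's hypotheses are admissible BY NAME),
and the sorry-free composition `KerrShieldedDataExist_of : A → B → C → KerrShieldedDataExist` (choose
`M = 1, r₀ = 1/2, r₂ = 1, r₃ = 3/2`).  Vocabulary: `IsRoughKSShield` (a `C²` metric = `PseudoRiemannianMetric (𝓡 3) 2`,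
a `C¹` symmetric `κ`, classical vacuum constraints written with the SAME `scalarCurvature/normSq/trace/divergence`
as `InitialDataSet.hamiltonianConstraintFn/momentumConstraintFn`, geodesic completeness, exact KS data on
`Kerr.slice 0 r₀` via `pullbackBilin`/`secondFundamentalForm` exactly as in the crux), `IsSmoothKSShield`,
`ShieldBlock` (= the crux's clause block VERBATIM, so the composition is bookkeeping).
-/

set_option linter.dupNamespace false
set_option linter.unusedVariables false

noncomputable section

open scoped Manifold ContDiff Topology
open Set Filter Function TopologicalSpace
open Literature.Geometry.Lorentzian

namespace Summit.FinalStateConjecture.FinalStateConjecture.Cruxes.KerrShieldedDataExist.NullGlueToATrappedSphere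

/-! ## §1 Vocabulary -/

/-- **Rough Kerr–Schild-shielded datum** (the output form of the Kehle–Unger harvest): a `C²` Riemannian metric
`g` on `E3` (a `PseudoRiemannianMetric` of class `2` on `T E3`) and a `C¹` field `κ` of symmetric bilinear forms
such that — for the Levi-Civita connection of `g`, granted its existence exactly as in `admissibleVacuumData` —
`(E3, g)` is geodesically complete and the vacuum constraints `R(g) − |κ|²_g + (tr_g κ)² = 0`,
`div_g κ − d(tr_g κ) = 0` hold CLASSICALLY at every point (same `scalarCurvature/normSq/trace/divergence` as
`InitialDataSet.hamiltonianConstraintFn` / `momentumConstraintFn`), and such that on the Kerr–Schild slice region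
`Kerr.slice 0 r₀ = {‖y‖ > r₀}` (inclusion `Subtype.val`) the pair `(g, κ)` IS the data induced on the slice
`{t* = 0}` of Schwarzschild(`M`) in ingoing Kerr–Schild coordinates (`Kerr.sliceEmbed`, future unit normal
`Kerr.sliceNormal`; Cook, Living Rev. Relativ. 3 (2000) §3.2.2). [cite: arXiv:2304.08455, Cor. 2] -/
def IsRoughKSShield [Kerr.Facts]
    (g : PseudoRiemannianMetric (𝓡 3) 2 E3 (TangentSpace (𝓡 3) : E3 → Type _))
    (κ : E3 → E3 →L[ℝ] E3 →L[ℝ] ℝ) (M r₀ : ℝ) : Prop :=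
  g.IsRiemannian ∧ (∀ (y : E3) (v w : E3), κ y v w = κ y w v) ∧ ContDiff ℝ 1 κ ∧
  (∀ [Fact ((1 : ℕ∞ω) ≤ 2)] [g.HasLeviCivita],
    IsGeodesicallyComplete g.leviCivita ∧
    ∀ y : E3,
      g.scalarCurvature y - g.normSq y (κ y).toLinearMap₁₂ + g.trace y (κ y).toLinearMap₁₂ ^ 2 = 0 ∧
      g.divergence κ y -
          (show TangentSpace (𝓡 3) y →L[ℝ] ℝ from
            mfderiv (𝓡 3) 𝓘(ℝ, ℝ) (fun x : E3 => g.trace x (κ x).toLinearMap₁₂) y).toLinearMap = 0) ∧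
  (∀ y : Kerr.slice 0 r₀,
    pullbackBilin (I := 𝓡 3) (I' := 𝓘(ℝ, E3)) (Subtype.val : Kerr.slice 0 r₀ → E3) g.val y =
      pullbackBilin (I := 𝓘(ℝ, E4)) (I' := 𝓘(ℝ, E3)) (Kerr.sliceEmbed 0 r₀) (Kerr.smoothMetric M 0 r₀).val y) ∧
  (∀ [(Kerr.smoothMetric M 0 r₀).HasLeviCivita] (y : Kerr.slice 0 r₀),
    (pullbackBilin (I := 𝓡 3) (I' := 𝓘(ℝ, E3)) (Subtype.val : Kerr.slice 0 r₀ → E3) κ y).toLinearMap₁₂ =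
      (Kerr.smoothMetric M 0 r₀).secondFundamentalForm 𝓘(ℝ, E3) (Kerr.sliceEmbed 0 r₀) (Kerr.sliceNormal M 0 r₀) y)

/-- **Smooth Kerr–Schild-shielded datum**: a smooth datum `D` on `E3`, vacuum and complete (Levi-Civita
existence granted, as in `admissibleVacuumData`), which on `ρ(Kerr.slice a r₃)` — `ρ` a linear isometry of `E3`
(rotating the spin axis to `e_z`) — IS the data of the Kerr–Schild slice `{t* = 0}` of Kerr(`m`,`a`)
(`Kerr.sliceEmbed a r₃`, `Kerr.sliceNormal m a r₃`). This is the output form of Li–Mei-type interior gluing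
(arXiv:2005.01249 Thm 2.2 / Prop 4.1: "exterior region exactly a Kerr slice"). [cite: arXiv:2005.01249, Prop. 4.1] -/
def IsSmoothKSShield [Kerr.Facts] (D : InitialDataSet (𝓡 3) E3) (m a r₃ : ℝ) (ρ : E3 ≃ₗᵢ[ℝ] E3) : Prop :=
  (∀ [D.metric.HasLeviCivita], D.IsVacuumConstraintSolution ∧ D.IsComplete) ∧
  (∀ y : Kerr.slice a r₃,
    pullbackBilin (I := 𝓡 3) (I' := 𝓘(ℝ, E3)) (fun z : Kerr.slice a r₃ => ρ (z : E3)) D.h.inner y =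
      pullbackBilin (I := 𝓘(ℝ, E4)) (I' := 𝓘(ℝ, E3)) (Kerr.sliceEmbed a r₃) (Kerr.smoothMetric m a r₃).val y) ∧
  (∀ [(Kerr.smoothMetric m a r₃).HasLeviCivita] (y : Kerr.slice a r₃),
    (pullbackBilin (I := 𝓡 3) (I' := 𝓘(ℝ, E3)) (fun z : Kerr.slice a r₃ => ρ (z : E3)) D.k y).toLinearMap₁₂ =
      (Kerr.smoothMetric m a r₃).secondFundamentalForm 𝓘(ℝ, E3) (Kerr.sliceEmbed a r₃) (Kerr.sliceNormal m a r₃) y)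

/-- **The crux's clause block, VERBATIM** (everything after `∃ D ∈ admissibleVacuumData E3, ∃ (M a r₁ : ℝ) (hM : 0 ≤ M)`
in `SwallowTheDatum.KerrShieldedDataExist`), so that
`KerrShieldedDataExist ≡ ∀ [Kerr.Facts], ∃ D ∈ admissibleVacuumData E3, ∃ M a r₁ hM, ShieldBlock D M a r₁ hM`
definitionally (checked by `shieldBlock_iff` below). [cite: LiMei2020, Thm 2.2] -/
def ShieldBlock [Literature.Geometry.Lorentzian.Kerr.Facts] (D : InitialDataSet (𝓡 3) E3) (M a r₁ : ℝ) (hM : 0 ≤ M) : Prop :=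
  ∃ (T : ℝ → ℝ) (φ : Literature.Geometry.Lorentzian.Kerr.slice a r₁ → Literature.Geometry.Lorentzian.E3) (ψ : Literature.Geometry.Lorentzian.Kerr.slice a r₁ → Literature.Geometry.Lorentzian.Kerr.region a r₁) (ν : Literature.Geometry.Lorentzian.NormalField 𝓘(ℝ, Literature.Geometry.Lorentzian.E4) ψ), |a| < M ∧ Literature.Geometry.Lorentzian.Kerr.rMinus M a < r₁ ∧ r₁ < Literature.Geometry.Lorentzian.Kerr.rPlus M a ∧ T = (fun r : ℝ => Real.smoothTransition (r / (4 * M) - 1) * (((M) / Real.sqrt ((M) ^ 2 - (a) ^ 2)) * (Literature.Geometry.Lorentzian.Kerr.rPlus M a * Real.log (r - Literature.Geometry.Lorentzian.Kerr.rPlus M a) - Literature.Geometry.Lorentzian.Kerr.rMinus M a * Real.log (r - Literature.Geometry.Lorentzian.Kerr.rMinus M a)) - ((M) / Real.sqrt ((M) ^ 2 - (a) ^ 2)) * (Literature.Geometry.Lorentzian.Kerr.rPlus M a * Real.log ((4 * M) - Literature.Geometry.Lorentzian.Kerr.rPlus M a) - Literature.Geometry.Lorentzian.Kerr.rMinus M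 a * Real.log ((4 * M) - Literature.Geometry.Lorentzian.Kerr.rMinus M a)))) ∧ IsCompact (Set.range φ)ᶜ ∧ Topology.IsOpenEmbedding φ ∧ ContMDiff 𝓘(ℝ, Literature.Geometry.Lorentzian.E3) (𝓡 3) ((⊤ : ℕ∞) : WithTop ℕ∞) φ ∧ (∀ y : Literature.Geometry.Lorentzian.Kerr.slice a r₁, (ψ y : Literature.Geometry.Lorentzian.E4) = Literature.Geometry.Lorentzian.E4.ofTimeSpace (T (Literature.Geometry.Lorentzian.Kerr.radius a (Literature.Geometry.Lorentzian.E4.ofTimeSpace 0 (y : Literature.Geometry.Lorentzian.E3)))) (y : Literature.Geometry.Lorentzian.E3)) ∧ (Literature.Geometry.Lorentzian.Kerr.smoothMetric M a r₁).IsSpacelikeImmersion 𝓘(ℝ, Literature.Geometry.Lorentzian.E3) ψ ∧ (Literature.Geometry.Lorentzian.Kerr.smoothMetric M a r₁).IsFutureUnitNormal 𝓘(ℝ, Literature.Geometry.Lorentzian.E3) ((Literature.Geometry.Lorentzian.Kerr.timeOrientation M a r₁ hM).ofLE le_top) ψ ν ∧ (∀ y : Literature.Geometry.Lorentzian.Kerr.slice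 a r₁, Literature.Geometry.Lorentzian.pullbackBilin (I := 𝓡 3) (I' := 𝓘(ℝ, Literature.Geometry.Lorentzian.E3)) φ (D).h.inner y = Literature.Geometry.Lorentzian.pullbackBilin (I := 𝓘(ℝ, Literature.Geometry.Lorentzian.E4)) (I' := 𝓘(ℝ, Literature.Geometry.Lorentzian.E3)) ψ (Literature.Geometry.Lorentzian.Kerr.smoothMetric M a r₁).val y) ∧ (∀ [(Literature.Geometry.Lorentzian.Kerr.smoothMetric M a r₁).HasLeviCivita] (y : Literature.Geometry.Lorentzian.Kerr.slice a r₁), (Literature.Geometry.Lorentzian.pullbackBilin (I := 𝓡 3) (I' := 𝓘(ℝ, Literature.Geometry.Lorentzian.E3)) φ (D).k y).toLinearMap₁₂ = (Literature.Geometry.Lorentzian.Kerr.smoothMetric M a r₁).secondFundamentalForm 𝓘(ℝ, Literature.Geometry.Lorentzian.E3) ψ ν y)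

/-- Sanity (definitional): the crux is `∃ D ∈ 𝓓, ∃ M a r₁ hM, ShieldBlock D M a r₁ hM` under `[Kerr.Facts]`. [folklore] -/
theorem shieldBlock_iff :
    Summit.FinalStateConjecture.FinalStateConjecture.Theses.SwallowTheDatum.KerrShieldedDataExist ↔
      ∀ [Literature.Geometry.Lorentzian.Kerr.Facts],
        ∃ D ∈ admissibleVacuumData E3, ∃ (M a r₁ : ℝ) (hM : 0 ≤ M), ShieldBlock D M a r₁ hM :=
  Iff.rfl

/-! ## §2 The registered obligations, by name -/

namespace Registered

/-- Statement of `stub_roughShieldOfNullGluing` (Kehle–Unger harvest). -/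
def stub_roughShieldOfNullGluing : Prop :=
  ∀ [Literature.Geometry.Lorentzian.Kerr.Facts] (M r₀ : ℝ), 0 < M → 0 < r₀ → r₀ < 2 * M →
    ∃ (g : PseudoRiemannianMetric (𝓡 3) 2 E3 (TangentSpace (𝓡 3) : E3 → Type _))
      (κ : E3 → E3 →L[ℝ] E3 →L[ℝ] ℝ), IsRoughKSShield g κ M r₀

/-- Statement of `stub_roughCollarRegluing` (rough interior, 4-parameter Kerr–Schild collar regluing). -/
def stub_roughCollarRegluing : Prop :=
  ∀ [Literature.Geometry.Lorentzian.Kerr.Facts] (M r₀ r₂ r₃ : ℝ),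
    0 < M → 0 < r₀ → r₀ < r₂ → r₂ < r₃ → r₃ < 2 * M → ∀ ε : ℝ, 0 < ε →
    ∀ (g : PseudoRiemannianMetric (𝓡 3) 2 E3 (TangentSpace (𝓡 3) : E3 → Type _))
      (κ : E3 → E3 →L[ℝ] E3 →L[ℝ] ℝ), IsRoughKSShield g κ M r₀ →
      ∃ (D : InitialDataSet (𝓡 3) E3) (m a : ℝ) (ρ : E3 ≃ₗᵢ[ℝ] E3),
        |m - M| < ε ∧ |a| < ε ∧
        |a| < m ∧ Kerr.rMinus m a < r₃ ∧ r₃ < Kerr.rPlus m a ∧ IsSmoothKSShield D m a r₃ ρ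

/-- Statement of `stub_bentLeafPatching` (patch in the Boyer–Lindquist bend, certify admissibility and the slice clause). -/
def stub_bentLeafPatching : Prop :=
  ∀ [Literature.Geometry.Lorentzian.Kerr.Facts] (D : InitialDataSet (𝓡 3) E3) (m a r₃ : ℝ) (hm : 0 ≤ m)
    (ρ : E3 ≃ₗᵢ[ℝ] E3), |a| < m → Kerr.rMinus m a < r₃ → r₃ < Kerr.rPlus m a → IsSmoothKSShield D m a r₃ ρ →
    ∃ D' ∈ admissibleVacuumData E3, ShieldBlock D' m a r₃ hm

end Registered

/-! ## §3 Registered stubs -/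

/-- **stub_roughShieldOfNullGluing** (Kehle–Unger harvest; size XL as Lean, L on paper; TRUE modulo the
SKETCHED Cor. 2 of arXiv:2304.08455 (p. 19 "Sketch of the proof": `ε → 0` subsequence + Cauchy stability)).
For every `M > 0` and `0 < r₀ < 2M` there is a ROUGH KS-SHIELDED DATUM `(g, κ)` on `E3` (`IsRoughKSShield`):
`C² × C¹`, complete, vacuum classically, exactly the Schwarzschild(`M`) Kerr–Schild slice data on `{‖y‖ > r₀}`.
Proof route: Kehle–Unger Thm A/Cor. 2 with `R ∈ (r₀, 2M)` (gluing radius free: "Let M > 0, R > 0"), the pasted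
`C²` spacetime of §4 (p. 18: left slab by Luk's characteristic local existence, right region, exact region
`𝓔 = {U ≤ U₂, V ≥ V₂}`; flat diamond `D(B)` to the future/past of the flat ball inside the bottom sphere); the
hypersurface Σ' = late KS slice `{t* = T₁, r > r₀}` (inside `𝓔`: `U ≤ e^{−T₁/4M} < U₂`, `v ≥ T₁ ≥ v₀`) ∪
past-directed spherically symmetric bend `t* = T₁ − S(r)` on `(r_c, r₀)` meeting `C = {U = U₂}` at
`S_c` (`r_c < r₀ ≤ R` ⇒ `V(S_c) ≥ V₂`) ∪ a spacelike leaf hugging `C` in the left slab down to `v = v₁` ∪ crossing of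
`C̲⁺_{S₁}` ∪ flat ball in `D(B)`; `Σ' ≅ ℝ³` with the KS Cartesian coordinates outside `r₀`; induced `(g, κ)` is `C² × C¹`
(metric `C²` across `C`, p. 18 L33; `C^{2+m}` across `C̲⁺_{S₁}` by Def. 2.2 sphere-data matching; smooth elsewhere),
vacuum by Gauss–Codazzi pointwise, complete (compact core ∪ complete KS end).
Leans on: Kehle–Unger 2024 Thm A, Cor. 2, §4, Lemma 4.1; Luk, IMRN 2012 (char. local existence); HKM low-regularity
well-posedness (K–U Rem. 1.5); tree: `Kerr.slice/sliceEmbed/sliceNormal/smoothMetric` (a = 0), `Kerr.region`,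
`Negative.conormalForm_zero_spin_neg_of_lt` (any slope ≥ 0 is spacelike inside `r < 2M`), `HypersurfaceConstraints`
(Gauss half), `KerrHorizonCausality` (KS causal bookkeeping).  NOT in tree: Kruskal extension, characteristic IVP. -/
theorem stub_roughShieldOfNullGluing :
    ∀ [Literature.Geometry.Lorentzian.Kerr.Facts] (M r₀ : ℝ), 0 < M → 0 < r₀ → r₀ < 2 * M →
      ∃ (g : PseudoRiemannianMetric (𝓡 3) 2 E3 (TangentSpace (𝓡 3) : E3 → Type _))
        (κ : E3 → E3 →L[ℝ] E3 →L[ℝ] ℝ), IsRoughKSShield g κ M r₀ := by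
  sorry

/-- **stub_roughCollarRegluing** (THE HEART — HARDEST; size XL; unprinted at this regularity). For `0 < r₀ < r₂ < r₃ < 2M`,
EVERY rough KS-shielded datum `(g, κ)` (exact Schwarzschild(`M`) KS data outside `r₀`) yields a SMOOTH complete vacuum
datum `D` on `E3` which outside radius `r₃` (after a linear isometry `ρ`) IS the Kerr–Schild slice data of a nearby
sub-extremal Kerr(`m`,`a`), `ε`-close to (`M`, 0) for any prescribed `ε > 0`, whose horizons still bracket the junction:
`|a| < m`, `r₋(m,a) < r₃ < r₊(m,a)`.
Intended proof: (1) mollify `(g, κ)` on `{‖y‖ ≤ r₂}` with a cutoff supported inside the exact zone — smooth data, constraint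
violation supported in `{‖y‖ < r₂ + δ}` and `→ 0` in `C⁰` (even `L^∞`-small: `g ∈ C²`, `κ ∈ C¹` ⇒ `R(g_ε) → R(g)`, `∂κ_ε → ∂κ`
uniformly); (2) blend on the collar `{r₂ + δ < ‖y‖ < r₃ − δ}` with the exact Kerr(`m`, 𝐚) KS-slice data (smooth 4-parameter
family through Schwarzschild(`M`) at 𝐚 = 0; mismatch `O(|m − M| + |𝐚|)` in every `C^k` of the collar); (3) Corvino–Schoen /
Chruściel–Delay localized deformation on the BALL `Ω = {‖y‖ < r₃}` with weights vanishing to infinite order at `∂Ω`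
(Chruściel–Delay, Mém. SMF 94 (2003) §3, gr-qc/0301073; Corvino–Schoen, JDG 73 (2006)); cokernel of the LIMIT background on
`Ω` = KIDs of `(g, κ)` on `Ω` ⊆ restrictions of the Schwarzschild Killing data `∂_t ⊕ so(3)` (unique continuation of the
overdetermined KID system from the exact collar; `dim ≤ 4`), absorbed by `(m, 𝐚)` exactly as in Li–Mei arXiv:2005.01249
Prop. 4.1 / Chruściel–Delay 2003 §8 (Brouwer degree: `∂(E, 𝐉)/∂(m, 𝐚)` nondegenerate at Schwarzschild); (4) LOW-REGULARITY
UNIFORMITY (backgrounds `g_ε → g` only in `C² × C¹`): freeze the adjoint — `δ = ψ² DΦ*_{(g₀,κ₀)}(N, Y)` at a FIXED smooth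
`C²`-close background (e.g. `g_{ε₀}`); `P_ε = DΦ_{(g_ε,κ_ε)} ψ² DΦ*_{(g₀,κ₀)}` is 4th order in `N` (2nd in `Y`) with continuous
top-order and uniformly bounded lower-order coefficients (only `g_ε, ∂g_ε, ∂²g_ε, κ_ε, ∂κ_ε` enter), a small perturbation of the
coercive `P_{ε₀}` (no kernel on the complement of the ≤ 4 KIDs; kernel-freeness is `C² × C¹`-open by the standard compactness
argument since `Ric(g_ε) → Ric(g)` in `C⁰`), so weighted `L²`/`L^p` estimates are uniform in `ε`; Picard in weighted `H⁴ ∋ (N,Y) ↦ δ ∈ H²`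
(`Q : H² → L²` quadratically bounded in 3D: `H¹ ⊂ L⁶`, `H² ⊂ L^∞`) closes because the violation is `o(1)` in `L²`; elliptic
bootstrap at fixed `ε` gives `C^∞`, exponential weights give vanishing to all orders at `∂Ω`; (5) small `C²` change ⇒ still
Riemannian and complete; `(m, a = |𝐚|) → (M, 0)` ⇒ window. `ρ` rotates the axis of 𝐚 to `e_z`.
Why it might fail: step (4) is not in print (Chruściel–Delay Thm 3.6 asks `g₀ ∈ W^{k+4,∞}`; the frozen-adjoint trick is the
planner's); if it fails, the repair is `C^m` (m ≥ 4) transversal Kehle–Unger gluing — open.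
Leans on: tree `InitialDataSet`, `PseudoRiemannianMetric` (class 2) API, `Kerr.data/slice/sliceEmbed/sliceNormal` (KS family,
smooth in `(m, a)` including `a → 0`), `Kerr.data_isVacuumConstraintSolution` (named; `a = 0` case PROVED:
`Kerr.data_isVacuumConstraintSolution_zero`), `WeightedNorms`; print: Corvino–Schoen 2006, Chruściel–Delay 2003 (§3 weighted
spaces, §8.2 Kerr family / KIDs of Schwarzschild), Li–Mei 2020 Prop. 4.1, Beig–Chruściel–Schoen (KIDs), ADN/Calderón–Zygmund
`L^p` theory with continuous coefficients. -/
theorem stub_roughCollarRegluing :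
    ∀ [Literature.Geometry.Lorentzian.Kerr.Facts] (M r₀ r₂ r₃ : ℝ),
      0 < M → 0 < r₀ → r₀ < r₂ → r₂ < r₃ → r₃ < 2 * M → ∀ ε : ℝ, 0 < ε →
      ∀ (g : PseudoRiemannianMetric (𝓡 3) 2 E3 (TangentSpace (𝓡 3) : E3 → Type _))
        (κ : E3 → E3 →L[ℝ] E3 →L[ℝ] ℝ), IsRoughKSShield g κ M r₀ →
        ∃ (D : InitialDataSet (𝓡 3) E3) (m a : ℝ) (ρ : E3 ≃ₗᵢ[ℝ] E3),
          |m - M| < ε ∧ |a| < ε ∧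
          |a| < m ∧ Kerr.rMinus m a < r₃ ∧ r₃ < Kerr.rPlus m a ∧ IsSmoothKSShield D m a r₃ ρ := by
  sorry

/-- **stub_bentLeafPatching** (size L; no PDE; reusable by EVERY witness blueprint of this crux — Li–Mei Σ⁺, bag of gold, K–U).
A smooth complete vacuum datum on `E3` which is the Kerr(`m`,`a`) KS slice outside `r₃ ∈ (r₋, r₊)` (after the isometry `ρ`)
yields an ADMISSIBLE datum satisfying the crux's block with the SAME `(m, a, r₃)`: (1) PATCH — the typed bent leaf
`ψ = graph (bentHeight m a)` over `Kerr.slice a r₃` equals `Kerr.sliceEmbed` on `{r ≤ 4m}` (`Negative.bentHeight_eq_zero_of_le`,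
`graph_eq_sliceEmbed_of_le`) and `r₃ < r₊ ≤ 2m < 4m` (`Negative.rPlus_le_two_mul`), so `D' := D` on `ρ({r < 4m}) ∪ (range φ)ᶜ`,
`D' := φ_*(ψ^*g_{m,a}, K_ν(ψ))` on `φ(Kerr.slice a r₃)`, `φ := ρ ∘ Subtype.val`, is a well-defined SMOOTH datum (the two agree on the
open overlap `ρ({r₃ < r < 4m})`); (2) `φ`: `IsCompact (range φ)ᶜ` (= `ρ` of the closed confocal ellipsoid), open embedding, `C^∞`;
(3) slice clause: `ψ` spacelike for all `|a| < m` (`Negative.conormalForm_bentSlope_neg` + `mfderiv ψ v = (T′ dr v, v)`,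
`g(N,N) = conormalForm/Σ`, `Kerr.bilin_pos_of_orthogonal`; on `r ≤ 4m` literally `Kerr.isSpacelikeImmersion_sliceEmbed_holds`),
`ν := −g♯n/|n|` future unit normal (`Kerr.isFutureUnitNormal_sliceNormal_holds` near the junction); (4) vacuum: `D` part given, exact part
by Gauss–Codazzi in vacuum Kerr (`HypersurfaceConstraints`; KS case = named fact `Kerr.data_isVacuumConstraintSolution`); complete
(compact core ∪ properly embedded BL end, `h ≥ c δ` far out); (5) admissibility's END: the existential chart `e` = `φ` followed by the
radial shift `ỹ = (ϱ(r)/r) y`, `r = ϱ(1 + m/2ϱ)²` (quasi-isotropic; isotropic for `a = 0`, where the far leaf is the time-symmetric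
`t = const` slice, `k ≡ 0`): `h − (1 + 2m/ϱ)δ = O₂(ϱ⁻²)`, `k = O₁(a m ϱ⁻³)` ⇒ DR rates `o₂(ϱ⁻¹)/o₁(ϱ⁻²)` with room; `IsSoleEnd`:
the complement of a far region is `(range φ)ᶜ ∪ φ({r ≤ R'})`, compact; `isClosed_far` by properness.
Why it might fail: only Lean size (the `secondFundamentalForm` of the graph needs `secondFundamentalForm_apply`, a named fact;
completeness of patched data needs a Hopf–Rinow-free argument via `IsGeodesicallyComplete`).
Leans on: landed `Theorems/KerrShieldedDataExist/Negative/*` (bent height, slope caps, conormal certificate, `psi_eq_graph`),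
`KerrData`, `KerrHyperboloidalLeaves` (`…_sliceEmbed_holds`, `…_sliceNormal_holds`), `AsymptoticFlatness` (`AFEnd`,
`IsStronglyAsymptoticallyFlatDR`), `InitialDataPullback`, `Hypersurface(Constraints)`; print: Cook 2000 §3.2.2, Dafermos–Rodnianski
arXiv:0811.0354 §5.1 & App. B, Brandt–Seidel (quasi-isotropic Kerr), Bartnik 1986 §1. -/
theorem stub_bentLeafPatching :
    ∀ [Literature.Geometry.Lorentzian.Kerr.Facts] (D : InitialDataSet (𝓡 3) E3) (m a r₃ : ℝ) (hm : 0 ≤ m)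
      (ρ : E3 ≃ₗᵢ[ℝ] E3), |a| < m → Kerr.rMinus m a < r₃ → r₃ < Kerr.rPlus m a → IsSmoothKSShield D m a r₃ ρ →
      ∃ D' ∈ admissibleVacuumData E3, ShieldBlock D' m a r₃ hm := by
  sorry

/-! ## §4 Kernel-checked composition: the three stubs prove the crux BY NAME -/

/-- **The line closes the crux.** With `M = 1`, exact radius `r₀ = 1/2`, collar `(r₂, r₃) = (1, 3/2) ⊂ (r₀, 2M)`:
harvest (A) ⇒ rough KS-shielded datum; reglue (B) ⇒ smooth Kerr(`m`,`a`)-KS-shielded complete vacuum datum with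
`r₋ < 3/2 < r₊` (`ε = 1`); patch + certify (C) ⇒ an admissible datum satisfying the crux's block with `r₁ = 3/2`. Pure logic
over the three named obligations; `0 ≤ m` from `|a| < m`. -/
theorem KerrShieldedDataExist_of (hA : Registered.stub_roughShieldOfNullGluing)
    (hB : Registered.stub_roughCollarRegluing) (hC : Registered.stub_bentLeafPatching) :
    Summit.FinalStateConjecture.FinalStateConjecture.Theses.SwallowTheDatum.KerrShieldedDataExist := by
  intro hF
  obtain ⟨g, κ, hg⟩ := hA 1 (1 / 2) one_pos (by norm_num) (by norm_num)
  obtain ⟨D, m, a, ρ, -, -, ha, hw₁, hw₂, hS⟩ :=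
    hB 1 (1 / 2) 1 (3 / 2) one_pos (by norm_num) (by norm_num) (by norm_num) (by norm_num) 1 one_pos g κ hg
  have hm : 0 ≤ m := ((abs_nonneg a).trans_lt ha).le
  obtain ⟨D', hD', hblock⟩ := hC D m a (3 / 2) hm ρ ha hw₁ hw₂ hS
  exact ⟨D', hD', m, a, 3 / 2, hm, hblock⟩

/-- Wiring check: the registered stubs (verbatim restatements, definitionally the named obligations) feed the
composition, so the crux decl is inhabited modulo exactly the three declared `sorry`s. -/
example : Summit.FinalStateConjecture.FinalStateConjecture.Theses.SwallowTheDatum.KerrShieldedDataExist :=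
  KerrShieldedDataExist_of stub_roughShieldOfNullGluing stub_roughCollarRegluing stub_bentLeafPatching

end Summit.FinalStateConjecture.FinalStateConjecture.Cruxes.KerrShieldedDataExist.NullGlueToATrappedSphere

end
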